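import Summits.Ventures.HodgeRepro2.T5SU11LegendreHeine
import Mathlib.Analysis.SpecialFunctions.Stirling

/-!
# The asymptotic of the leading coefficient: `√n · C(2n,n)/4ⁿ → 1/√π`, i.e. `√n · c(−2n) → 1/√π`

The coefficients `a_n = C(2n,n)/4ⁿ` of `(1 − z)^{−1/2}` (`T5SU11LegendreHeine.binomHalf`) — the leading coefficients
`c(−2n)` of Heine's expansion `φ_{2n+2}(a_t) = Σ_k a_k a_{n−k} e^{(4k−2n)t}` — satisfy, in terms of Mathlib's Stirling
sequence `s_n = n!/(√(2n) (n/e)ⁿ)`, the exact identity **`√n · a_n = s_{2n}/s_n²`** (`sqrt_mul_binomHalf_eq`), so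
Stirling's formula `s_n → √π` (`Stirling.tendsto_stirlingSeq_sqrt_pi`) gives **`√n · a_n → 1/√π`**
(`tendsto_sqrt_mul_binomHalf`): the `c`-function at the even integers decays like `c(−2n) ∼ 1/√(πn)`
(`tendsto_sqrt_mul_cfun`), and `a_n → 0` (`tendsto_binomHalf`). Also the monotonicity `a_{n+1} ≤ a_n ≤ 1`
(`binomHalf_antitone`, `binomHalf_le_one`) and the ratio bound `a_m/a_{m+j} ≤ (1 + 1/(2m+1))^j`
(`binomHalf_div_le`), used by the Laplace–Heine asymptotic of `T5SU11LegendreLaplaceHeine`. Nothing is claimed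
about (N).

Blind lane: Mathlib + the HodgeRepro2 prefix only; no sorry; axioms ⊆ {propext, Classical.choice,
Quot.sound}.
-/

namespace Summit.Ventures.HodgeRepro2.T5SU11LegendreCentralBinomial

open Filter Topology Finset Stirling
open T5SU11SphericalAsymptotic T5SU11LegendreHeine

/-! ### Monotonicity -/

/-- `a_{n+1} ≤ a_n`. -/
theorem binomHalf_succ_le (n : ℕ) : binomHalf (n + 1) ≤ binomHalf n := by
  have h := binomHalf_succ n
  have hp := binomHalf_pos n
  have hn : (0 : ℝ) ≤ n := Nat.cast_nonneg n
  nlinarith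

/-- `n ↦ a_n` is antitone. -/
theorem binomHalf_antitone : Antitone binomHalf := antitone_nat_of_succ_le binomHalf_succ_le

/-- `a_n ≤ 1`. -/
theorem binomHalf_le_one (n : ℕ) : binomHalf n ≤ 1 := by
  have := binomHalf_antitone (Nat.zero_le n)
  rwa [binomHalf_zero] at this

/-- **The ratio bound `a_m/a_{m+j} ≤ (1 + 1/(2m+1))^j`** (each step `a_i/a_{i+1} = (2i+2)/(2i+1) = 1 + 1/(2i+1)`). -/
theorem binomHalf_div_le (m j : ℕ) : binomHalf m / binomHalf (m + j) ≤ (1 + 1 / (2 * (m : ℝ) + 1)) ^ j := by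
  induction j with
  | zero => simp [(binomHalf_pos m).ne']
  | succ j ih =>
    have h := binomHalf_succ (m + j)
    have hp := binomHalf_pos (m + j)
    have hp' := binomHalf_pos (m + j + 1)
    have hm : (0 : ℝ) ≤ m := Nat.cast_nonneg m
    have hj : (0 : ℝ) ≤ j := Nat.cast_nonneg j
    -- `a_{m+j}/a_{m+j+1} = 1 + 1/(2(m+j)+1) ≤ 1 + 1/(2m+1)`
    have hstep : binomHalf (m + j) / binomHalf (m + j + 1) ≤ 1 + 1 / (2 * (m : ℝ) + 1) := by
      rw [div_le_iff₀ hp']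
      have e : binomHalf (m + j) = ((m + j : ℕ) + 1 : ℝ) / ((m + j : ℕ) + 1 / 2 : ℝ) * binomHalf (m + j + 1) := by
        rw [div_mul_eq_mul_div, eq_div_iff (by positivity)]
        linarith [h]
      rw [e]
      push_cast
      have h1 : ((m : ℝ) + j + 1) / ((m : ℝ) + j + 1 / 2) ≤ 1 + 1 / (2 * (m : ℝ) + 1) := by
        rw [div_le_iff₀ (by positivity)]
        have : 1 + 1 / (2 * (m : ℝ) + 1) = (2 * (m : ℝ) + 2) / (2 * (m : ℝ) + 1) := by
          field_simp
          ring
        rw [this, div_mul_eq_mul_div, le_div_iff₀ (by positivity)]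
        nlinarith
      exact mul_le_mul_of_nonneg_right h1 hp'.le
    calc binomHalf m / binomHalf (m + (j + 1))
        = binomHalf m / binomHalf (m + j) * (binomHalf (m + j) / binomHalf (m + j + 1)) := by
          rw [← add_assoc]
          field_simp
      _ ≤ (1 + 1 / (2 * (m : ℝ) + 1)) ^ j * (1 + 1 / (2 * (m : ℝ) + 1)) :=
          mul_le_mul ih hstep (by positivity) (by positivity)
      _ = (1 + 1 / (2 * (m : ℝ) + 1)) ^ (j + 1) := by ring

/-! ### Stirling -/

/-- **`√n · a_n = s_{2n}/s_n²`** for `n ≥ 1`, `s_n` Mathlib's Stirling sequence. -/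
theorem sqrt_mul_binomHalf_eq {n : ℕ} (hn : 0 < n) :
    Real.sqrt n * binomHalf n = stirlingSeq (2 * n) / stirlingSeq n ^ 2 := by
  have hn' : (0 : ℝ) < n := by exact_mod_cast hn
  have hfac : ((2 * n).choose n : ℝ) * ((n.factorial : ℝ) * (n.factorial : ℝ)) = ((2 * n).factorial : ℝ) := by
    have h := Nat.choose_mul_factorial_mul_factorial (show n ≤ 2 * n by omega)
    rw [show 2 * n - n = n by omega] at h
    exact_mod_cast (by rw [← mul_assoc]; exact h)
  have hs1 : Real.sqrt (2 * ((2 * n : ℕ) : ℝ)) = 2 * Real.sqrt n := by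
    rw [show (2 * ((2 * n : ℕ) : ℝ)) = 2 ^ 2 * n by push_cast; ring, Real.sqrt_mul (by norm_num),
      Real.sqrt_sq (by norm_num)]
  have hs2 : Real.sqrt (2 * (n : ℝ)) ^ 2 = 2 * n := Real.sq_sqrt (by positivity)
  have hsn : 0 < Real.sqrt n := Real.sqrt_pos.mpr hn'
  have he : 0 < Real.exp 1 := Real.exp_pos 1
  unfold stirlingSeq binomHalf
  simp only [div_pow, mul_pow]
  rw [hs2, hs1]
  push_cast
  have h4 : (4 : ℝ) ^ n = 2 ^ (2 * n) := by rw [pow_mul]; norm_num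
  rw [h4, ← hfac]
  have hsn2 : Real.sqrt (n : ℝ) ^ 2 = n := Real.sq_sqrt hn'.le
  field_simp
  rw [hsn2]
  ring

/-- **`√n · a_n → 1/√π`** (Stirling). -/
theorem tendsto_sqrt_mul_binomHalf :
    Tendsto (fun n : ℕ => Real.sqrt n * binomHalf n) atTop (𝓝 (1 / Real.sqrt Real.pi)) := by
  have hπ : Real.sqrt Real.pi ≠ 0 := (Real.sqrt_pos.mpr Real.pi_pos).ne'
  have h2 : Tendsto (fun n : ℕ => stirlingSeq (2 * n)) atTop (𝓝 (Real.sqrt Real.pi)) :=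
    tendsto_stirlingSeq_sqrt_pi.comp (tendsto_id.const_mul_atTop' two_pos)
  have h := h2.div (tendsto_stirlingSeq_sqrt_pi.pow 2) (pow_ne_zero 2 hπ)
  have e : Real.sqrt Real.pi / Real.sqrt Real.pi ^ 2 = 1 / Real.sqrt Real.pi := by
    field_simp
  rw [e] at h
  refine h.congr' (eventually_atTop.mpr ⟨1, fun n hn => ?_⟩)
  simp only [Pi.div_apply]
  exact (sqrt_mul_binomHalf_eq (by omega)).symm

/-- **`√n · c(−2n) → 1/√π`**: the `c`-function at the even integers. -/
theorem tendsto_sqrt_mul_cfun :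
    Tendsto (fun n : ℕ => Real.sqrt n * cfun (-(2 * (n : ℝ)))) atTop (𝓝 (1 / Real.sqrt Real.pi)) := by
  simp only [← binomHalf_eq_cfun]
  exact tendsto_sqrt_mul_binomHalf

/-- `a_n → 0`. -/
theorem tendsto_binomHalf : Tendsto binomHalf atTop (𝓝 0) := by
  have h1 := tendsto_sqrt_mul_binomHalf
  have h2 : Tendsto (fun n : ℕ => (Real.sqrt n)⁻¹) atTop (𝓝 0) := by
    have : Tendsto (fun n : ℕ => Real.sqrt (n : ℝ)) atTop atTop :=
      Real.tendsto_sqrt_atTop.comp tendsto_natCast_atTop_atTop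
    exact tendsto_inv_atTop_zero.comp this
  have h := h1.mul h2
  rw [mul_zero] at h
  refine h.congr' (eventually_atTop.mpr ⟨1, fun n hn => ?_⟩)
  have hsn : Real.sqrt (n : ℝ) ≠ 0 := (Real.sqrt_pos.mpr (by exact_mod_cast hn)).ne'
  field_simp

end Summit.Ventures.HodgeRepro2.T5SU11LegendreCentralBinomial
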